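import Summits.ABC.IUTFork.Cor312NaiveThm311
import Summits.ABC.IUTFork.Cor312PinnedRegionsTwist
import HarnessLib

/-!
# [IUTchIII] Cor. 3.12 — the C-13 coricity cost `hfrob` is SATISFIABLE: at the naive base it holds
for every indeterminacy member, so the pinned reading's étale coricity is unconditional there

Record-only file (D-0012) of the abc-iut cell (D-0067 Cor. 3.12 strategy TEAM C «étale-picture /
multiradiality», seat abc-iut-c312-13, row C-13b of `HOME/plan/C312-TEAMS.md`); TAKES NO SIDE;
proof-only. Row C-13 (`Cor312PinnedRegionsTwist.lean`) isolated the cost of the pinned reading's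
étale coricity as ONE explicit identification — `hfrob : starAut Φ '' (S.col P.n).frobΨ m =
(S.col n').frobΨ m`, the cross-column identification of Kummer images. This file answers the
non-vacuity question for that hypothesis (the PR-3 N3 pattern): at the NAIVE `p`-adic base of record
(`NaiveWitness.naiveFull`, the contentful typed-Thm-3.11 model) the identification HOLDS for EVERY
member of `⟨(Ind1) ∪ (Ind2)⟩` and every pair of columns (`naive_frobCompat`): the Kummer image
`frobΨ m = starAut (twist m) '' Ψ_v` is SIGN-INVARIANT (`image_Psi_of_actsBySigns` — `Ψ_v` is
torsion-saturated) and the naive columns are constant, so both sides are `Ψ_v`. CONSEQUENCE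
(`pinnedRegions_recolumn_naive`): over the naive base, `PinnedRegions` transports along the étale
recolumn UNCONDITIONALLY — C-13's conditional coricity with its `hfrob` discharged. HONEST SCOPE:
this witnesses satisfiability only; the cost is visible exactly at instances with genuinely
COLUMN-DEPENDENT Kummer images (none in the tree yet — the naive model's columns differ only by the
sign twist, which `Ψ_v` absorbs); a failure witness would need `frobΨ` families not related by the
indeterminacy action, which is PR-2's modelling lane, not this file's. Nothing here asserts any pin
holds for any setting, and nothing here asserts Cor. 3.12. [claim: Mochizuki2012, status: disputed]
for the quoted clauses; proofs are [folklore] bookkeeping over landed witness API.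
-/

noncomputable section

namespace Summit.ABC.IUTFork.Cor312Vol.NaiveWitness

open Thm311 Cor312 Cor312.Checks Cor312.IdentifiedNonVacuity Literature.IUT.LogThetaLattice

variable (p : ℕ) [hp : Fact p.Prime]

omit hp in
/-- **Every naive Kummer image is the coric splitting monoid**: the sign twist that defines
`frobΨ m` is absorbed by the torsion-saturated `Ψ_v` (at every column and every `m`). [folklore] -/
theorem naive_frobPsi_eq (n m : ℤ) (v : toyIndex.V) (hv : v ∈ toyIndex.Vbad) :
    (((naiveFull p).toLatticeSituation).col n).frobΨ m v hv = Psi p v := by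
  show signShells.starAut (twist m) v '' Psi p v = Psi p v
  exact image_Psi_of_actsBySigns p (twist_actsBySigns m) v

omit hp in
/-- **`hfrob` HOLDS AT THE NAIVE BASE, for every indeterminacy member and every pair of columns**:
row C-13's cross-column Kummer identification is satisfiable — non-vacuity of the conditional
coricity `thetaPinned_recolumn_of_frobCompat`. [folklore] -/
theorem naive_frobCompat (n n' : ℤ) {Φ : signShells.PacketAut}
    (hΦ : Φ ∈ Subgroup.closure (signShells.Ind1Family ∪ signShells.Ind2Family))
    (m : ℤ) (v : toyIndex.V) (hv : v ∈ toyIndex.Vbad) :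
    signShells.starAut Φ v '' (((naiveFull p).toLatticeSituation).col n).frobΨ m v hv =
      (((naiveFull p).toLatticeSituation).col n').frobΨ m v hv :=
  calc signShells.starAut Φ v '' (((naiveFull p).toLatticeSituation).col n).frobΨ m v hv
      = signShells.starAut Φ v '' Psi p v := by
        rw [naive_frobPsi_eq p n m v hv]
    _ = Psi p v := image_Psi_of_actsBySigns p (actsBySigns_of_mem_closure hΦ) v
    _ = (((naiveFull p).toLatticeSituation).col n').frobΨ m v hv :=
        (naive_frobPsi_eq p n' m v hv).symm

omit hp in
/-- **Over the naive base the pinned reading's étale coricity is UNCONDITIONAL**: row C-13's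
`pinnedRegions_recolumn_of_frobCompat` with its `hfrob` discharged by `naive_frobCompat` — for any
setting over the naive lattice situation, any pinning data, and any étale transport, the pinned pair
transports (the Θ-pin onto the new column's own Kummer data, the q-datum covariantly). [folklore] -/
theorem pinnedRegions_recolumn_naive
    (P : Cor312.Setting ((naiveFull p).toLatticeSituation).toSituation)
    (ρ : (∀ v : toyIndex.V, v ∈ toyIndex.Vbad →
        Set (((naiveFull p).toLatticeSituation).L.StarPacket v)) →
      ∀ (j : toyIndex.Label) (vQ : toyIndex.VQ),
        Set (((naiveFull p).toLatticeSituation).L.Packet j vQ))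
    (qK : ∀ v : toyIndex.V, v ∈ toyIndex.Vbad →
      Set (((naiveFull p).toLatticeSituation).L.StarPacket v))
    (n' : ℤ) (Φ : ((naiveFull p).toLatticeSituation).toSituation.L.PacketAut)
    (hD : ((naiveFull p).toLatticeSituation).toSituation.D n' =
      (((naiveFull p).toLatticeSituation).toSituation.D P.n).map Φ)
    (hΦ : Φ ∈ Subgroup.closure (((naiveFull p).toLatticeSituation).L.Ind1Family ∪
      ((naiveFull p).toLatticeSituation).L.Ind2Family))
    (hpin : PinnedRegions ((naiveFull p).toLatticeSituation) P ρ qK) :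
    PinnedRegions ((naiveFull p).toLatticeSituation) (P.recolumn n' Φ hD) ρ
      (fun v hv => ((naiveFull p).toLatticeSituation).L.starAut Φ v '' qK v hv) :=
  pinnedRegions_recolumn_of_frobCompat ((naiveFull p).toLatticeSituation) P ρ qK n' Φ hD hΦ hpin
    (fun m v hv => naive_frobCompat p P.n n' hΦ m v hv)

end Summit.ABC.IUTFork.Cor312Vol.NaiveWitness

end
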